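import Literature.Topology.FourManifolds.PlumbingFraming
import Literature.Topology.FourManifolds.PlumbingHomology
import Literature.Topology.FourManifolds.SpinSphereAmbient
import Literature.Topology.FourManifolds.SpinProofs
import Literature.Topology.FourManifolds.KnotFraming
import HarnessLib

/-!
# Stable framings of the plumbed manifold along the core spheres

Topic `Literature/Topology/FourManifolds`; part of the proof that Kosinski's plumbing `M(4m)` is
stably parallelisable (A. Kosinski, *Differential Manifolds* (1993), VI.12: the tangent bundle of
the plumbing restricted to a core sphere is `TSᵏ ⊕ TSᵏ`, stably trivial; IX.(7.5)).

* `Plumbing.hasStableTangentFramingAlong_diag` — **an explicit framing of `T(Sᵏ × Sᵏ) ⊕ ℝ` along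
  the diagonal** `p ↦ (p, p)`: with `L_p` the tangent lift of the sphere
  (`exists_linear_lift_mfderiv_coe_sphere`) and `e₀, …, e_k` the standard basis of `ℝᵏ⁺¹`, the
  `2k + 1` sections `Bᵢ = ((L_p e_{i+1}, 0), ⟪e_{i+1}, p⟫)` (`i < k`) and
  `Cⱼ = ((L_p (⟪eⱼ, p⟫ e₀), L_p eⱼ), ⟪eⱼ, p⟫⟪e₀, p⟫)` (`j ≤ k`); a linear map of `T ⊕ ℝ` into
  `ℝᵏ⁺¹ × ℝᵏ⁺¹` takes them to `(e_{i+1}, 0)` and `(0, eⱼ)`, so they are linearly independent.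
* `Plumbing.hasStableTangentFramingAlong_core` — transported to the tube (`of_comp_subtype_val`)
  and pushed into the plumbed manifold along the tube embedding `ιᵥ` (`pushforward`; the
  differential of `ιᵥ` is injective, `Plumbing.injective_mfderiv_ι`): the plumbed manifold is
  stably framed along every core sphere `κᵥ(p) = ιᵥ(p, p)`.

Everything is proved; no named facts (D-0026).

## References

* A. Kosinski, *Differential Manifolds*, Academic Press 1993, VI.12, IX.(7.5). [Kosinski1993]
-/

open scoped Manifold ContDiff Topology RealInnerProductSpace
open Set Function Module Bundle Filter Topology

noncomputable section

namespace Literature.Topology.FourManifolds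

namespace Plumbing

/-- Local notation: `𝔼 n` is the model Euclidean space `EuclideanSpace ℝ (Fin n)`. -/
local notation "𝔼 " n:arg => EuclideanSpace ℝ (Fin n)

/-- Local notation: `𝕊 n` is the unit sphere in `EuclideanSpace ℝ (Fin (n + 1))`. -/
local notation "𝕊 " n:arg => (Metric.sphere (0 : EuclideanSpace ℝ (Fin (n + 1))) 1)

variable {k : ℕ} {c : ℝ}

/-! ### §1 The framing of `T(Sᵏ × Sᵏ) ⊕ ℝ` along the diagonal -/

section Diag

/-- The standard basis vector `eᵢ` of `ℝᵏ⁺¹`. [folklore] -/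
def sb (i : Fin (k + 1)) : 𝔼 (k + 1) := EuclideanSpace.single i 1

/-- `inner_sb_sb` (inner sb sb). [folklore] -/
theorem inner_sb_sb (i j : Fin (k + 1)) : ⟪(sb i : 𝔼 (k + 1)), sb j⟫ = if i = j then 1 else 0 := by
  rw [sb, sb, EuclideanSpace.inner_single_left]
  simp [PiLp.single_apply]

/-- The ambient derivative of the inclusion `Sᵏ ↪ ℝᵏ⁺¹` at `p`. [folklore] -/
abbrev Dincl (p : 𝕊 k) : TangentSpace (𝓡 k) p →L[ℝ] 𝔼 (k + 1) :=
  mfderiv (𝓡 k) 𝓘(ℝ, 𝔼 (k + 1)) ((↑) : (𝕊 k) → 𝔼 (k + 1)) p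

/-- A chosen tangent lift of the sphere: `D(incl)(p) (lift p w) = w - ⟪p, w⟫ p`. [folklore] -/
def lift (p : 𝕊 k) : 𝔼 (k + 1) →ₗ[ℝ] TangentSpace (𝓡 k) p :=
  Classical.choose (exists_linear_lift_mfderiv_coe_sphere (F := 𝔼 (k + 1)) (n := k)) p

/-- `Dincl_lift` (Dincl lift). [folklore] -/
theorem Dincl_lift (p : 𝕊 k) (w : 𝔼 (k + 1)) :
    Dincl p (lift p w) = w - ⟪(p : 𝔼 (k + 1)), w⟫ • (p : 𝔼 (k + 1)) :=
  Classical.choose_spec (exists_linear_lift_mfderiv_coe_sphere (F := 𝔼 (k + 1)) (n := k)) p w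

/-- Tangent vectors are orthogonal to the base point. [folklore] -/
theorem inner_Dincl (p : 𝕊 k) (v : TangentSpace (𝓡 k) p) : ⟪(p : 𝔼 (k + 1)), Dincl p v⟫ = 0 :=
  inner_mfderiv_coe_sphere_eq_zero (n := k) p v

/-- `inner_Dincl'` (inner Dincl'). [folklore] -/
theorem inner_Dincl' (p : 𝕊 k) (v : TangentSpace (𝓡 k) p) : ⟪Dincl p v, (p : 𝔼 (k + 1))⟫ = 0 := by
  rw [real_inner_comm]; exact inner_Dincl p v

/-- Continuity of lifted sections of `TSᵏ` (tree `continuous_totalSpaceMk_lift_sphere`). [folklore] -/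
theorem continuous_lift_section {S : Type*} [TopologicalSpace S] {f : S → 𝕊 k} (hf : Continuous f)
    {w : S → 𝔼 (k + 1)} (hw : Continuous w) :
    Continuous fun p => (TotalSpace.mk' (𝔼 k) (f p) (lift (f p) (w p)) : TangentBundle (𝓡 k) (𝕊 k)) :=
  continuous_totalSpaceMk_lift_sphere (fun x => ⇑(lift x)) Dincl_lift hf hw

/-- **The sections of the diagonal framing**, indexed by `Fin k ⊕ Fin (k + 1)`:
`Bᵢ = ((L e_{i+1}, L 0), ⟪e_{i+1}, p⟫)`, `Cⱼ = ((L (⟪eⱼ, p⟫ e₀), L eⱼ), ⟪eⱼ, p⟫⟪e₀, p⟫)`. [folklore] -/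
def diagSec : Fin k ⊕ Fin (k + 1) → (𝕊 k) → (𝔼 k × 𝔼 k) × ℝ
  | Sum.inl i, p => ((lift p (sb i.succ), lift p 0), ⟪sb i.succ, (p : 𝔼 (k + 1))⟫)
  | Sum.inr j, p => ((lift p (⟪sb j, (p : 𝔼 (k + 1))⟫ • sb 0), lift p (sb j)),
      ⟪sb j, (p : 𝔼 (k + 1))⟫ * ⟪sb 0, (p : 𝔼 (k + 1))⟫)

/-- Continuity of the tangent parts of the diagonal sections into `T(Sᵏ × Sᵏ)`. [folklore] -/
theorem continuous_diagSec_fst (i : Fin k ⊕ Fin (k + 1)) :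
    Continuous fun p : 𝕊 k => (TotalSpace.mk' (𝔼 k × 𝔼 k) (p, p) (diagSec i p).1 :
      TangentBundle ((𝓡 k).prod (𝓡 k)) ((𝕊 k) × (𝕊 k))) := by
  rcases i with i | j
  · exact continuous_totalSpaceMk_prod (f := fun p : 𝕊 k => p) (g := fun p : 𝕊 k => p)
      (X := fun p : 𝕊 k => lift p (sb i.succ)) (Y := fun p : 𝕊 k => lift p 0)
      (continuous_lift_section continuous_id continuous_const)
      (continuous_lift_section continuous_id continuous_const)
  · have hw : Continuous fun p : 𝕊 k => ⟪(sb j : 𝔼 (k + 1)), (p : 𝔼 (k + 1))⟫ • (sb 0 : 𝔼 (k + 1)) :=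
      by fun_prop
    exact continuous_totalSpaceMk_prod (f := fun p : 𝕊 k => p) (g := fun p : 𝕊 k => p)
      (X := fun p : 𝕊 k => lift p (⟪(sb j : 𝔼 (k + 1)), (p : 𝔼 (k + 1))⟫ • (sb 0 : 𝔼 (k + 1))))
      (Y := fun p : 𝕊 k => lift p (sb j))
      (continuous_lift_section continuous_id hw)
      (continuous_lift_section continuous_id continuous_const)

/-- Continuity of the real parts of the diagonal sections. [folklore] -/
theorem continuous_diagSec_snd (i : Fin k ⊕ Fin (k + 1)) : Continuous fun p : 𝕊 k => (diagSec i p).2 := by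
  rcases i with i | j
  · exact continuous_const.inner continuous_subtype_val
  · exact (continuous_const.inner continuous_subtype_val).mul (continuous_const.inner continuous_subtype_val)

/-- The linear map `Ψ_p : (T_p × T_p) × ℝ → ℝᵏ⁺¹ × ℝᵏ⁺¹` straightening the diagonal frame:
`((v, w), t) ↦ (a - ⟪b', p⟫ e₀, b')` with `a = Dv + t p`, `b' = Dw + ⟪a, e₀⟫ p`. [folklore] -/
def diagLin (p : 𝕊 k) : ((𝔼 k × 𝔼 k) × ℝ) →ₗ[ℝ] (𝔼 (k + 1) × 𝔼 (k + 1)) :=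
  let D : (𝔼 k) →ₗ[ℝ] 𝔼 (k + 1) := (Dincl p).toLinearMap
  let Φ₁ : ((𝔼 k × 𝔼 k) × ℝ) →ₗ[ℝ] (𝔼 (k + 1) × 𝔼 (k + 1)) :=
    ((D.comp ((LinearMap.fst ℝ _ _).comp (LinearMap.fst ℝ _ _))) +
      (LinearMap.toSpanSingleton ℝ _ (p : 𝔼 (k + 1))).comp (LinearMap.snd ℝ _ _)).prod
      (D.comp ((LinearMap.snd ℝ _ _).comp (LinearMap.fst ℝ _ _)))
  let Φ₂ : (𝔼 (k + 1) × 𝔼 (k + 1)) →ₗ[ℝ] (𝔼 (k + 1) × 𝔼 (k + 1)) :=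
    (LinearMap.fst ℝ _ _).prod (LinearMap.snd ℝ _ _ +
      (LinearMap.toSpanSingleton ℝ _ (p : 𝔼 (k + 1))).comp ((innerₗ (𝔼 (k + 1)) (sb 0)).comp (LinearMap.fst ℝ _ _)))
  let Φ₃ : (𝔼 (k + 1) × 𝔼 (k + 1)) →ₗ[ℝ] (𝔼 (k + 1) × 𝔼 (k + 1)) :=
    (LinearMap.fst ℝ _ _ -
      (LinearMap.toSpanSingleton ℝ _ (sb 0)).comp ((innerₗ (𝔼 (k + 1)) (p : 𝔼 (k + 1))).comp (LinearMap.snd ℝ _ _))).prod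
      (LinearMap.snd ℝ _ _)
  Φ₃.comp (Φ₂.comp Φ₁)

/-- `diagLin_apply` (diagLin apply). [folklore] -/
theorem diagLin_apply (p : 𝕊 k) (v w : 𝔼 k) (t : ℝ) :
    diagLin p ((v, w), t) =
      (Dincl p v + t • (p : 𝔼 (k + 1)) -
          ⟪(p : 𝔼 (k + 1)), Dincl p w + ⟪(sb 0 : 𝔼 (k + 1)), Dincl p v + t • (p : 𝔼 (k + 1))⟫ • (p : 𝔼 (k + 1))⟫ • sb 0,
        Dincl p w + ⟪(sb 0 : 𝔼 (k + 1)), Dincl p v + t • (p : 𝔼 (k + 1))⟫ • (p : 𝔼 (k + 1))) := by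
  simp [diagLin, LinearMap.prod_apply, LinearMap.toSpanSingleton_apply, innerₗ_apply_apply]
  exact ⟨rfl, rfl⟩

/-- **The straightening map sends the diagonal sections to standard basis vectors.** [folklore] -/
theorem diagLin_diagSec (p : 𝕊 k) (i : Fin k ⊕ Fin (k + 1)) :
    diagLin p (diagSec i p) = Sum.elim (fun i : Fin k => ((sb i.succ : 𝔼 (k + 1)), (0 : 𝔼 (k + 1))))
      (fun j : Fin (k + 1) => ((0 : 𝔼 (k + 1)), (sb j : 𝔼 (k + 1)))) i := by
  have hpp : ⟪(p : 𝔼 (k + 1)), (p : 𝔼 (k + 1))⟫ = 1 := by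
    rw [real_inner_self_eq_norm_sq, norm_eq_of_mem_sphere, one_pow]
  rcases i with i | j
  · change diagLin p ((lift p (sb i.succ), lift p 0), ⟪sb i.succ, (p : 𝔼 (k + 1))⟫) = (sb i.succ, 0)
    rw [diagLin_apply, Dincl_lift, Dincl_lift, real_inner_comm (p : 𝔼 (k + 1)) (sb i.succ), sub_add_cancel,
      inner_sb_sb, if_neg (Fin.succ_ne_zero i).symm]
    simp
  · change diagLin p ((lift p (⟪sb j, (p : 𝔼 (k + 1))⟫ • sb 0), lift p (sb j)),
      ⟪sb j, (p : 𝔼 (k + 1))⟫ * ⟪sb 0, (p : 𝔼 (k + 1))⟫) = (0, sb j)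
    have h00 : ⟪(sb 0 : 𝔼 (k + 1)), sb 0⟫ = 1 := by rw [inner_sb_sb, if_pos rfl]
    rw [diagLin_apply, Dincl_lift, Dincl_lift, real_inner_smul_right, real_inner_comm (p : 𝔼 (k + 1)) (sb 0),
      sub_add_cancel, real_inner_smul_right, h00, mul_one, real_inner_comm (p : 𝔼 (k + 1)) (sb j),
      sub_add_cancel, sub_self]

/-- The straightened family is linearly independent (part of the product standard basis). [folklore] -/
theorem linearIndependent_diag_target :
    LinearIndependent ℝ (Sum.elim (fun i : Fin k => ((sb i.succ : 𝔼 (k + 1)), (0 : 𝔼 (k + 1))))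
      (fun j : Fin (k + 1) => ((0 : 𝔼 (k + 1)), (sb j : 𝔼 (k + 1))))) := by
  set b := (EuclideanSpace.basisFun (Fin (k + 1)) ℝ).toBasis with hb
  have hfam : Sum.elim (fun i : Fin k => ((sb i.succ : 𝔼 (k + 1)), (0 : 𝔼 (k + 1))))
      (fun j : Fin (k + 1) => ((0 : 𝔼 (k + 1)), (sb j : 𝔼 (k + 1)))) = ⇑(b.prod b) ∘ Sum.map Fin.succ id := by
    funext i
    rcases i with i | j
    · refine Prod.ext ?_ ?_
      · simp [hb, sb]
      · simp [hb]
    · refine Prod.ext ?_ ?_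
      · simp [hb]
      · simp [hb, sb]
  rw [hfam]
  exact (b.prod b).linearIndependent.comp _ (Sum.map_injective.2 ⟨Fin.succ_injective k, injective_id⟩)

/-- **The diagonal sections are linearly independent at every point.** [folklore] -/
theorem linearIndependent_diagSec (p : 𝕊 k) : LinearIndependent ℝ fun i => diagSec i p := by
  refine LinearIndependent.of_comp (diagLin p) ?_
  have : ⇑(diagLin p) ∘ (fun i => diagSec i p) = Sum.elim (fun i : Fin k => ((sb i.succ : 𝔼 (k + 1)), (0 : 𝔼 (k + 1))))
      (fun j : Fin (k + 1) => ((0 : 𝔼 (k + 1)), (sb j : 𝔼 (k + 1)))) := by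
    funext i; exact diagLin_diagSec p i
  rw [this]
  exact linearIndependent_diag_target

/-- `dim (ℝᵏ × ℝᵏ) + 1 = k + (k + 1)`. [folklore] -/
theorem finrank_prod_succ : finrank ℝ (𝔼 k × 𝔼 k) + 1 = k + (k + 1) := by
  rw [Module.finrank_prod, finrank_euclideanSpace_fin]; omega

/-- The reindexing `Fin (dim + 1) ≃ Fin k ⊕ Fin (k + 1)`. [folklore] -/
def diagIdx : Fin (finrank ℝ (𝔼 k × 𝔼 k) + 1) ≃ Fin k ⊕ Fin (k + 1) :=
  (finCongr finrank_prod_succ).trans finSumFinEquiv.symm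

/-- **`T(Sᵏ × Sᵏ) ⊕ ℝ` is framed along the diagonal** (explicitly). [cite: Kosinski1993, VI.12 p. 122] -/
theorem hasStableTangentFramingAlong_diag :
    HasStableTangentFramingAlong ((𝓡 k).prod (𝓡 k)) ((𝕊 k) × (𝕊 k)) (fun p : 𝕊 k => (p, p)) := by
  refine ⟨fun i p => diagSec (diagIdx i) p, fun i => continuous_diagSec_fst _, fun i => continuous_diagSec_snd _,
    fun p => ?_⟩
  exact (linearIndependent_diagSec p).comp _ diagIdx.injective

end Diag

/-! ### §2 The plumbed manifold is stably framed along every core sphere -/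

section Core

variable {n : ℕ} (hk : 2 ≤ k) (hc : IsParam c) (hkn : k + k = n + 1)

/-- The differential of `Quad.mk i` is injective (`pt ∘ mk i = id`). [folklore] -/
theorem injective_mfderiv_quadMk (i : Fin 4) (x : Tb k c) :
    Injective (mfderiv ((𝓡 k).prod (𝓡 k)) ((𝓡 k).prod (𝓡 k)) (Quad.mk i : Tb k c → Quad (Tb k c)) x) := by
  have hmk : MDifferentiableAt ((𝓡 k).prod (𝓡 k)) ((𝓡 k).prod (𝓡 k)) (Quad.mk i : Tb k c → Quad (Tb k c)) x :=
    ((Quad.contMDiff_mk (IX := (𝓡 k).prod (𝓡 k)) (n := 1) i).mdifferentiable one_ne_zero) x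
  have hpt : MDifferentiableAt ((𝓡 k).prod (𝓡 k)) ((𝓡 k).prod (𝓡 k)) (Quad.pt : Quad (Tb k c) → Tb k c) (Quad.mk i x) :=
    ((Quad.contMDiff_pt (IX := (𝓡 k).prod (𝓡 k)) (n := 1)).mdifferentiable one_ne_zero) _
  have hcomp := mfderiv_comp x hpt hmk
  have hid : (Quad.pt ∘ Quad.mk i : Tb k c → Tb k c) = id := funext fun y => Quad.pt_mk i y
  rw [hid, mfderiv_id] at hcomp
  intro v w hvw
  have := congrArg (mfderiv ((𝓡 k).prod (𝓡 k)) ((𝓡 k).prod (𝓡 k)) Quad.pt (Quad.mk i x)) hvw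
  rw [← ContinuousLinearMap.comp_apply, ← ContinuousLinearMap.comp_apply, ← hcomp] at this
  exact this

/-- **The differential of the tube embedding `ιᵥ` is injective** (`ιᵥ = inl/inr ∘ Quad.mk`, a
smooth embedding of the glued space composed with a summand inclusion). [folklore] -/
theorem injective_mfderiv_ι (v : Fin 8) (x : Tb k c) :
    Injective (mfderiv ((𝓡 k).prod (𝓡 k)) (𝓡 (n + 1)) (ι hk hc hkn v) x) := by
  have key : ∀ (a : Fin 4) (emb : Quad (Tb k c) → PV k c hk hc hkn)
      (hemb : Manifold.IsSmoothEmbedding ((𝓡 k).prod (𝓡 k)) (𝓡 (n + 1)) ∞ emb),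
      Injective (mfderiv ((𝓡 k).prod (𝓡 k)) (𝓡 (n + 1)) (emb ∘ Quad.mk a) x) := by
    intro a emb hemb
    have hmk : MDifferentiableAt ((𝓡 k).prod (𝓡 k)) ((𝓡 k).prod (𝓡 k)) (Quad.mk a : Tb k c → Quad (Tb k c)) x :=
      ((Quad.contMDiff_mk (IX := (𝓡 k).prod (𝓡 k)) (n := 1) a).mdifferentiable one_ne_zero) x
    have he : MDifferentiableAt ((𝓡 k).prod (𝓡 k)) (𝓡 (n + 1)) emb (Quad.mk a x) :=
      (hemb.contMDiff.mdifferentiable (by simp)) _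
    rw [mfderiv_comp x he hmk]
    have h1 : Injective (mfderiv ((𝓡 k).prod (𝓡 k)) (𝓡 (n + 1)) emb (Quad.mk a x)) :=
      Manifold.IsImmersionAt.mfderiv_injective (hemb.isImmersion.isImmersionAt (Quad.mk a x)) (by simp)
    exact h1.comp (injective_mfderiv_quadMk a x)
  rcases exists_vA_or_vB v with ⟨a, rfl⟩ | ⟨b, rfl⟩
  · rw [ι_vA]; exact key a _ (glueData hk hc hkn).isSmoothEmbedding_inl
  · rw [ι_vB]; exact key b _ (glueData hk hc hkn).isSmoothEmbedding_inr

/-- **The core sphere** `κᵥ(p) = ιᵥ(p, p)` of the `v`-th tube. [cite: Kosinski1993, VI.12 p. 120] -/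
def coreMap (v : Fin 8) (p : 𝕊 k) : PV k c hk hc hkn := ι hk hc hkn v (diagPt hc.lt_one p)

/-- `continuous_coreMap` (continuous coreMap). [folklore] -/
theorem continuous_coreMap (v : Fin 8) : Continuous (coreMap hk hc hkn v) :=
  (continuous_ι hk hc hkn v).comp (Continuous.subtype_mk (continuous_id.prodMk continuous_id) _)

/-- **The plumbed manifold is stably framed along each core sphere.** [cite: Kosinski1993, VI.12 p. 122] -/
theorem hasStableTangentFramingAlong_core (v : Fin 8) :
    HasStableTangentFramingAlong (𝓡 (n + 1)) (PV k c hk hc hkn) (coreMap hk hc hkn v) := by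
  -- along the diagonal of the tube
  have h1 : HasStableTangentFramingAlong ((𝓡 k).prod (𝓡 k)) (Tb k c) (fun p : 𝕊 k => diagPt hc.lt_one p) :=
    HasStableTangentFramingAlong.of_comp_subtype_val (Tb k c)
      (Continuous.subtype_mk (continuous_id.prodMk continuous_id) _) hasStableTangentFramingAlong_diag
  -- push along `ι v`
  have hdim : finrank ℝ (𝔼 k × 𝔼 k) = finrank ℝ (𝔼 (n + 1)) := by
    rw [Module.finrank_prod, finrank_euclideanSpace_fin, finrank_euclideanSpace_fin]; omega
  exact h1.pushforward ((contMDiff_ι hk hc hkn v).of_le (by simp)) (injective_mfderiv_ι hk hc hkn v) hdim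

end Core

/-! ### §3 Matching the core framings at the crossing points -/

section Match

variable {n : ℕ} (hk : 2 ≤ k) (hc : IsParam c) (hkn : k + k = n + 1)

/-- Edges of the tree are parent–child pairs. [folklore] -/
theorem eq_par_or_eq_par : ∀ v w : Fin 8, kosinskiGamma8 v w = 1 →
    (w ≠ 0 ∧ v = par w) ∨ (v ≠ 0 ∧ w = par v) := by
  decide

/-- `rotFrom p p = id`. [folklore] -/
theorem rotFrom_self_self {E : Type*} [NormedAddCommGroup E] [InnerProductSpace ℝ E] (p x : E) :
    rotFrom p p x = x := by
  conv_lhs => rw [← rotTo_self_self (p := p) x]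
  exact rotFrom_rotTo _ _ _

/-- **The plumbing map fixes the crossing point `(e, e)`.** [folklore] -/
theorem plumbMap_pole_pole (e : 𝕊 k) : plumbMap e (e, e) = (e, e) := by
  have h1 : plumbFst e (e, e) = e := Subtype.ext (rotTo_self_self (p := (e : 𝔼 (k + 1))) _)
  refine Prod.ext h1 ?_
  apply Subtype.ext
  change rotFrom ((plumbFst e (e, e) : 𝕊 k) : 𝔼 (k + 1)) e e = e
  rw [h1]
  exact rotFrom_self_self _ _

/-- The crossing point `(e_j, e_j)` lies in the plumbing domain `D_j`. [folklore] -/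
theorem pole_pole_mem_dom (j : Fin 3) : ((pole k j.val, pole k j.val) : (𝕊 k) × (𝕊 k)) ∈ dom k c j ↔ c < 1 := by
  rw [mem_dom, baseHt_apply, fibHt_apply, real_inner_self_eq_norm_sq, norm_eq_of_mem_sphere, one_pow]
  exact and_self_iff

/-- **When do two core points coincide?** `κᵥ(p) = κ_w(p')` iff `v = w, p = p'`, or `{v, w}` is an
edge and `p = p' = e_{vw}` (the crossing point). [cite: Kosinski1993, VI.12 p. 120] -/
theorem coreMap_eq_coreMap_iff {v w : Fin 8} {p p' : 𝕊 k} :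
    coreMap hk hc hkn v p = coreMap hk hc hkn w p' ↔
      (v = w ∧ p = p') ∨ (kosinskiGamma8 v w = 1 ∧ p = pole k (ecol v w).val ∧ p' = pole k (ecol v w).val) := by
  rw [coreMap, coreMap, ι_eq_ι_iff]
  constructor
  · rintro (⟨rfl, h⟩ | ⟨hvw, hdom, hpm⟩)
    · left; exact ⟨rfl, by simpa [diagPt, Subtype.ext_iff, Prod.ext_iff] using h⟩
    · right
      refine ⟨hvw, ?_⟩
      have h2 := congrArg (fun x : Tb k c => (x : (𝕊 k) × (𝕊 k))) hpm
      simp only [coe_diagPt] at h2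
      rw [coe_pm_of_mem hc hdom, coe_diagPt] at h2
      -- `(p', p') = plumbMap e (p, p) = (e, ?)` with first component `rotTo p e p = e`
      have hpe : ‖(p : 𝔼 (k + 1))‖ = ‖(pole k (ecol v w).val : 𝔼 (k + 1))‖ := by
        rw [norm_eq_of_mem_sphere, norm_eq_of_mem_sphere]
      have h0 : (p : 𝔼 (k + 1)) + (pole k (ecol v w).val : 𝔼 (k + 1)) ≠ 0 :=
        add_ne_zero_of_neg_one_lt_inner (norm_eq_of_mem_sphere _) (by
          have h1 : c < baseHt (pole k (ecol v w).val) ((p, p) : (𝕊 k) × (𝕊 k)) := hdom.1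
          rw [baseHt_apply] at h1
          change c < ⟪(p : 𝔼 (k + 1)), (pole k (ecol v w).val : 𝔼 (k + 1))⟫ at h1
          linarith [hc.nonneg])
      have hfst : p' = pole k (ecol v w).val := by
        have hf : p' = plumbFst (pole k (ecol v w).val) (p, p) := congrArg Prod.fst h2
        apply Subtype.ext
        rw [hf, coe_plumbFst]
        exact rotTo_self hpe h0
      subst hfst
      refine ⟨?_, rfl⟩
      -- second component: `e = rotFrom e e p = p`
      have hs : pole k (ecol v w).val = plumbSnd (pole k (ecol v w).val) (p, p) := congrArg Prod.snd h2
      have hs' := congrArg (fun q : 𝕊 k => (q : 𝔼 (k + 1))) hs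
      simp only [coe_plumbSnd, coe_plumbFst] at hs'
      change (pole k (ecol v w).val : 𝔼 (k + 1)) =
        rotFrom (rotTo (p : 𝔼 (k + 1)) (pole k (ecol v w).val) p) (pole k (ecol v w).val) p at hs'
      rw [rotTo_self hpe h0, rotFrom_self_self] at hs'
      exact Subtype.ext hs'.symm
  · rintro (⟨rfl, rfl⟩ | ⟨hvw, rfl, rfl⟩)
    · exact Or.inl ⟨rfl, rfl⟩
    · refine Or.inr ⟨hvw, (pole_pole_mem_dom _).2 hc.lt_one, ?_⟩
      apply Subtype.ext
      rw [coe_pm_of_mem hc ((pole_pole_mem_dom _).2 hc.lt_one), coe_diagPt]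
      exact (plumbMap_pole_pole _).symm

/-- `injective_coreMap` (injective coreMap). [folklore] -/
theorem injective_coreMap (v : Fin 8) : Injective (coreMap hk hc hkn v) := by
  intro p p' h
  rcases (coreMap_eq_coreMap_iff hk hc hkn).1 h with ⟨-, h⟩ | ⟨hvv, -, -⟩
  · exact h
  · rw [kosinskiGamma8_diag] at hvv; norm_num at hvv

/-- **The crossing point** of the core `v ≠ 0` with its parent core. [folklore] -/
def xpt (v : Fin 8) : 𝕊 k := pole k (ecol (par v) v).val

/-- The cores of `v` and `par v` cross at `xpt v`. [folklore] -/
theorem coreMap_par_xpt {v : Fin 8} (hv : v ≠ 0) :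
    coreMap hk hc hkn (par v) (xpt v) = coreMap hk hc hkn v (xpt v) :=
  (coreMap_eq_coreMap_iff hk hc hkn).2 (Or.inr ⟨gamma8_par v hv, rfl, rfl⟩)

/-- **A core frame**: a stable framing of the plumbed manifold along the core sphere `κᵥ`, as
data. [folklore] -/
def IsCoreFrame (v : Fin 8) (s : Fin (finrank ℝ (𝔼 (n + 1)) + 1) → (𝕊 k) → 𝔼 (n + 1) × ℝ) : Prop :=
  (∀ i, Continuous fun p => (TotalSpace.mk' (𝔼 (n + 1)) (coreMap hk hc hkn v p) (s i p).1 :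
      TangentBundle (𝓡 (n + 1)) (PV k c hk hc hkn))) ∧
    (∀ i, Continuous fun p => (s i p).2) ∧ ∀ p, LinearIndependent ℝ fun i => s i p

/-- Every core carries a core frame. [folklore] -/
theorem exists_isCoreFrame (v : Fin 8) : ∃ s, IsCoreFrame hk hc hkn v s :=
  hasStableTangentFramingAlong_core hk hc hkn v

/-- **Matching step**: a core frame can be changed to take a prescribed basis value at one point.
[folklore] -/
theorem exists_isCoreFrame_eq_at (v : Fin 8) (p₀ : 𝕊 k)
    (b : Module.Basis (Fin (finrank ℝ (𝔼 (n + 1)) + 1)) ℝ (𝔼 (n + 1) × ℝ)) :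
    ∃ s, IsCoreFrame hk hc hkn v s ∧ ∀ i, s i p₀ = b i := by
  obtain ⟨t, ht1, ht2, ht3, ht4⟩ := HasStableTangentFramingAlong.exists_eq_at (continuous_coreMap hk hc hkn v)
    (hasStableTangentFramingAlong_core hk hc hkn v) p₀ b
  exact ⟨t, ⟨ht1, ht2, ht3⟩, ht4⟩

/-- `card (Fin (dim + 1)) = dim (E × ℝ)`. [folklore] -/
theorem card_fin_eq_finrank : Fintype.card (Fin (finrank ℝ (𝔼 (n + 1)) + 1)) = finrank ℝ (𝔼 (n + 1) × ℝ) := by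
  rw [Fintype.card_fin, Module.finrank_prod, Module.finrank_self]

/-- **Matched core frames**: core frames on all eight cores which agree at the seven crossing
points (process the vertices in the tree order and rotate each child's frame, by a constant
change of frame, onto its parent's frame at the crossing point). [cite: Kosinski1993, VI.12 p. 122] -/
theorem exists_matched_coreFrames :
    ∃ F : Fin 8 → Fin (finrank ℝ (𝔼 (n + 1)) + 1) → (𝕊 k) → 𝔼 (n + 1) × ℝ,
      (∀ v, IsCoreFrame hk hc hkn v (F v)) ∧ ∀ v, v ≠ 0 → ∀ i, F v i (xpt v) = F (par v) i (xpt v) := by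
  classical
  -- invariant after `m` steps: matched for `v < m`
  have step : ∀ m : ℕ, ∃ F : Fin 8 → Fin (finrank ℝ (𝔼 (n + 1)) + 1) → (𝕊 k) → 𝔼 (n + 1) × ℝ,
      (∀ v, IsCoreFrame hk hc hkn v (F v)) ∧ ∀ v, v ≠ 0 → v.val < m → ∀ i, F v i (xpt v) = F (par v) i (xpt v) := by
    intro m
    induction m with
    | zero =>
      choose F hF using exists_isCoreFrame hk hc hkn
      exact ⟨F, hF, fun v _ h => absurd h (Nat.not_lt_zero _)⟩
    | succ m ih =>
      obtain ⟨F, hF, hmatch⟩ := ih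
      by_cases hm : m < 8
      swap
      · exact ⟨F, hF, fun v hv _ => hmatch v hv (by omega)⟩
      set v₀ : Fin 8 := ⟨m, hm⟩ with hv₀
      by_cases h0 : v₀ = 0
      · refine ⟨F, hF, fun v hv hlt => hmatch v hv ?_⟩
        have : m = 0 := by simpa [hv₀, Fin.ext_iff] using h0
        subst this
        exact absurd (show v = 0 from Fin.ext (by omega)) hv
      -- the new frame on the core `v₀`, matched to the parent's frame at `xpt v₀`
      let b : Module.Basis (Fin (finrank ℝ (𝔼 (n + 1)) + 1)) ℝ (𝔼 (n + 1) × ℝ) :=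
        basisOfLinearIndependentOfCardEqFinrank ((hF (par v₀)).2.2 (xpt v₀)) card_fin_eq_finrank
      have hb : ∀ i, b i = F (par v₀) i (xpt v₀) := fun i => by
        simp only [b, coe_basisOfLinearIndependentOfCardEqFinrank]
      obtain ⟨s, hs, hsb⟩ := exists_isCoreFrame_eq_at hk hc hkn v₀ (xpt v₀) b
      refine ⟨Function.update F v₀ s, fun v => ?_, fun v hv hlt i => ?_⟩
      · by_cases hvv : v = v₀
        · subst hvv; rw [Function.update_self]; exact hs
        · rw [Function.update_of_ne hvv]; exact hF v
      · have hpar_ne : par v ≠ v₀ := by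
          intro hpv
          have h1 := par_lt v hv
          rw [hpv, Fin.lt_def] at h1
          simp only [hv₀] at h1
          omega
        rw [Function.update_of_ne hpar_ne]
        by_cases hvv : v = v₀
        · subst hvv
          rw [Function.update_self, hsb i, hb i]
        · rw [Function.update_of_ne hvv]
          have hlt' : v.val < m := by
            have : v.val ≠ m := fun h => hvv (Fin.ext (by simp [hv₀, h]))
            omega
          exact hmatch v hv hlt' i
  obtain ⟨F, hF, hmatch⟩ := step 8
  exact ⟨F, hF, fun v hv i => hmatch v hv v.isLt i⟩

end Match

/-! ### §4 The framing along the union of the cores -/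

section Union

variable {n : ℕ} (hk : 2 ≤ k) (hc : IsParam c) (hkn : k + k = n + 1)

/-- **The union of the core spheres** `C = ⋃ᵥ κᵥ(Sᵏ)`. [cite: Kosinski1993, VI.12 p. 120] -/
def coreUnion : Set (PV k c hk hc hkn) := ⋃ v, range (coreMap hk hc hkn v)

/-- A chosen matched family of core frames. [folklore] -/
def matchedFrames : Fin 8 → Fin (finrank ℝ (𝔼 (n + 1)) + 1) → (𝕊 k) → 𝔼 (n + 1) × ℝ :=
  Classical.choose (exists_matched_coreFrames hk hc hkn)

/-- `isCoreFrame_matchedFrames` (isCoreFrame matchedFrames). [folklore] -/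
theorem isCoreFrame_matchedFrames (v : Fin 8) : IsCoreFrame hk hc hkn v (matchedFrames hk hc hkn v) :=
  (Classical.choose_spec (exists_matched_coreFrames hk hc hkn)).1 v

/-- `matchedFrames_xpt` (matchedFrames xpt). [folklore] -/
theorem matchedFrames_xpt {v : Fin 8} (hv : v ≠ 0) (i : Fin (finrank ℝ (𝔼 (n + 1)) + 1)) :
    matchedFrames hk hc hkn v i (xpt v) = matchedFrames hk hc hkn (par v) i (xpt v) :=
  (Classical.choose_spec (exists_matched_coreFrames hk hc hkn)).2 v hv i

/-- **Matched frames agree wherever the cores meet.** [folklore] -/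
theorem matchedFrames_eq_of_coreMap_eq {v w : Fin 8} {p p' : 𝕊 k}
    (h : coreMap hk hc hkn v p = coreMap hk hc hkn w p') (i : Fin (finrank ℝ (𝔼 (n + 1)) + 1)) :
    matchedFrames hk hc hkn v i p = matchedFrames hk hc hkn w i p' := by
  rcases (coreMap_eq_coreMap_iff hk hc hkn).1 h with ⟨rfl, rfl⟩ | ⟨hvw, rfl, rfl⟩
  · rfl
  · rcases eq_par_or_eq_par v w hvw with ⟨hw, rfl⟩ | ⟨hv, rfl⟩
    · exact (matchedFrames_xpt hk hc hkn hw i).symm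
    · rw [ecol_comm]; exact matchedFrames_xpt hk hc hkn hv i

open Classical in
/-- **The sections on the union of the cores** (junk value `0` off the union). [folklore] -/
def unionSec (i : Fin (finrank ℝ (𝔼 (n + 1)) + 1)) (q : PV k c hk hc hkn) : 𝔼 (n + 1) × ℝ :=
  if h : ∃ v p, coreMap hk hc hkn v p = q then
    matchedFrames hk hc hkn (Classical.choose h) i (Classical.choose (Classical.choose_spec h)) else 0

/-- On a core, the union section is the matched frame. [folklore] -/
theorem unionSec_coreMap (i : Fin (finrank ℝ (𝔼 (n + 1)) + 1)) (v : Fin 8) (p : 𝕊 k) :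
    unionSec hk hc hkn i (coreMap hk hc hkn v p) = matchedFrames hk hc hkn v i p := by
  have h : ∃ w p', coreMap hk hc hkn w p' = coreMap hk hc hkn v p := ⟨v, p, rfl⟩
  rw [unionSec, dif_pos h]
  exact matchedFrames_eq_of_coreMap_eq hk hc hkn (Classical.choose_spec (Classical.choose_spec h)) i

/-- `coreMap` is a closed embedding. [folklore] -/
theorem isClosedEmbedding_coreMap (v : Fin 8) : IsClosedEmbedding (coreMap hk hc hkn v) :=
  (continuous_coreMap hk hc hkn v).isClosedEmbedding (injective_coreMap hk hc hkn v)

/-- Continuity on the range of a closed embedding from continuity of the composite. [folklore] -/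
theorem continuousOn_range_of_comp {X Y Z : Type*} [TopologicalSpace X] [TopologicalSpace Y] [TopologicalSpace Z]
    {e : X → Y} (he : IsEmbedding e) {G : Y → Z} (hG : Continuous (G ∘ e)) : ContinuousOn G (range e) := by
  rw [continuousOn_iff_continuous_restrict]
  have hval : (range e).restrict G = (G ∘ e) ∘ he.toHomeomorph.symm := by
    funext q
    obtain ⟨x, rfl⟩ : ∃ x, he.toHomeomorph x = q := he.toHomeomorph.surjective q
    rw [Function.comp_apply, Homeomorph.symm_apply_apply]
    rfl
  rw [hval]
  exact hG.comp he.toHomeomorph.symm.continuous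

/-- Continuity on a finite union of closed sets. [folklore] -/
theorem continuousOn_iUnion_fin {Y Z : Type*} [TopologicalSpace Y] [TopologicalSpace Z] {m : ℕ} {K : Fin m → Set Y}
    (hK : ∀ v, IsClosed (K v)) {G : Y → Z} (hG : ∀ v, ContinuousOn G (K v)) : ContinuousOn G (⋃ v, K v) := by
  classical
  have : ∀ T : Finset (Fin m), ContinuousOn G (⋃ v ∈ T, K v) := by
    intro T
    induction T using Finset.induction_on with
    | empty => simp
    | insert a T ha ih =>
      rw [Finset.set_biUnion_insert]
      exact (hG a).union_of_isClosed ih (hK a) (isClosed_biUnion_finset fun v _ => hK v)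
  have h := this Finset.univ
  simpa using h

/-- **The plumbed manifold is stably framed along the union of its core spheres.**
[cite: Kosinski1993, VI.12 p. 122] -/
theorem hasStableTangentFramingAlong_coreUnion :
    HasStableTangentFramingAlong (𝓡 (n + 1)) (PV k c hk hc hkn) (Subtype.val : coreUnion hk hc hkn → PV k c hk hc hkn) := by
  refine ⟨fun i q => unionSec hk hc hkn i q.1, fun i => ?_, fun i => ?_, fun q => ?_⟩
  · -- continuity of the tangent parts: on each (closed) core it is the matched frame
    have hG : ContinuousOn (fun q : PV k c hk hc hkn => (TotalSpace.mk' (𝔼 (n + 1)) q (unionSec hk hc hkn i q).1 :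
        TangentBundle (𝓡 (n + 1)) (PV k c hk hc hkn))) (coreUnion hk hc hkn) := by
      refine continuousOn_iUnion_fin (fun v => (isClosedEmbedding_coreMap hk hc hkn v).isClosed_range) fun v => ?_
      refine continuousOn_range_of_comp (isClosedEmbedding_coreMap hk hc hkn v).isEmbedding ?_
      have := (isCoreFrame_matchedFrames hk hc hkn v).1 i
      refine this.congr fun p => ?_
      simp only [Function.comp_apply, unionSec_coreMap]
    exact hG.comp_continuous continuous_subtype_val fun q => q.2
  · have hG : ContinuousOn (fun q : PV k c hk hc hkn => (unionSec hk hc hkn i q).2) (coreUnion hk hc hkn) := by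
      refine continuousOn_iUnion_fin (fun v => (isClosedEmbedding_coreMap hk hc hkn v).isClosed_range) fun v => ?_
      refine continuousOn_range_of_comp (isClosedEmbedding_coreMap hk hc hkn v).isEmbedding ?_
      have := (isCoreFrame_matchedFrames hk hc hkn v).2.1 i
      refine this.congr fun p => ?_
      simp only [Function.comp_apply, unionSec_coreMap]
    exact hG.comp_continuous continuous_subtype_val fun q => q.2
  · obtain ⟨q, hq⟩ := q
    obtain ⟨v, p, rfl⟩ : ∃ v p, coreMap hk hc hkn v p = q := by
      simpa [coreUnion, mem_iUnion, mem_range] using hq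
    simp only [unionSec_coreMap]
    exact (isCoreFrame_matchedFrames hk hc hkn v).2.2 p

end Union

end Plumbing

end Literature.Topology.FourManifolds
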